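import Literature.Geometry.DiscreteGeometry.ShellCensusSearchCheck
import HarnessLib

/-!
# The census growth search: part `10` of `16` of the run

Topic `Literature/Geometry/DiscreteGeometry`; computational lane (`native_decide`).  The frontier
of the two roots at depth `10` is split into `16` parts by index; this file certifies that part
`10` is searched `true` with fuel `40` (`ShellCensusSearchCheck.checkPart`).  Assembled in
`ShellCensusSearchFinal.lean`.
-/

namespace Literature.Geometry.DiscreteGeometry

namespace ShellCensusSearch

/-- **Part `10` of `16` of the census run returns `true`.** [folklore] -/
theorem checkPart_eq_true_10 : checkPart 10 16 10 40 = true := by native_decide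

end ShellCensusSearch

end Literature.Geometry.DiscreteGeometry
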